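import Mathlib.Tactic
import Mathlib.Data.ZMod.Basic
import Mathlib.Data.Rat.Lemmas
import HarnessLib

/-!
# Route `Langlands/SqrtFiveQuarticCovers`, certificate `CertS3H12` (sheet 4.7, carrier `X = X(s3,H12)` g7
# over `k = ℚ(√5)`): KERNEL ANCHORS II — the CASE-1 fibres of `X → E = 225a1` are QUADRATIC, not
# `k`-rational (the `R`-part of the cell's THEOREM (R′) «`X(s3,H12)(ℚ(√5))` = the 8 cusps»)

Cell `pub/lg-quartmod` (F-L1), engine seat eng-4 g3; companion of
`Theorems/SqrtFiveQuarticCoversCertS3H12Anchors.lean` (p672242).  E8-MODELS v2 (cell eng-4, kit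
j312432) states, for the named `k`-points `R ∈ {O, −2G, 2G+T, 2G−T}` of `E = 225a1`, the square
classes in `k` of the two branch functions `A = m² + 12m + 144` (the `X(s3)`-sheet) and
`B = (8t²−12t+7)/(5+2√5)` (the `H12`-sheet): `A(O) = 12²`, `B(O) = 27/c`; `A(−2G) = 28²`,
`B(−2G) ≡ 8/c`; `A(2G±T) ∉ k²`, `B(2G±T) ∉ k²`, `A·B ∈ k²` — so the fibre of `X` over each of them is
`4` points over a QUADRATIC extension of `k` (`k(√(27/c)) = ℚ(ζ₁₅)⁺`, `k(√(8/c)) = ℚ(√(5+√5))`,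
`k(√A) = ℚ(θ)`), none `k`-rational; with `Y₃(k) = 8` (rank `E′(k) = 0`, NAMED) this is THEOREM (R′)
«`X(k)` = 8 cusps».  The previous anchors file replayed the identities; THIS file replays the three
NON-membership claims, which are not ring identities but small Diophantine facts over `ℚ`:

* `ratCast_add_ratCast_mul_eq_zero` — `{1, r}` is `ℚ`-linearly independent in any field of
  characteristic `0` with `r² = 5` (else `r ∈ ℚ` and `5` would be a rational square; `5` is not a
  square mod `7`);
* `isSquare_norm_of_sq_eq` — if `(c + d·r)² = a + b·r` with `a b c d : ℚ` then
  `a² − 5b² = (c² − 5d²)²` is a rational square (the norm form of `ℚ(√5)`);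
* the four instances: `N(A(2G∓T)) = 125989 = 19²·349`, `121²·N(B(2G∓T)) = 8725·121`,
  `5²·N(B(O)) = 3645`, `5²·N(B(−2G)) = 320` are NOT rational squares (`≡ 3, 3, 5, 5 (mod 7)`,
  non-residues), hence `A(2G∓T)`, `B(2G∓T)`, `B(O)`, `B(−2G)` are not squares of elements of
  `ℚ + ℚr` — for both signs of `r`.

Every element of `k = ℚ⟮r⟯ ⊆ K` is `c + d·r` (`exists_rat_add_rat_mul_of_mem_adjoin`, CertS3H12 file),
so «not a square of an element `c + d·r`» is «not a square in `k`».  HONEST STATUS: support lemmas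
(no hypothesis, no definition, no named fact); they close nothing on the ledger; the COUNT
«`Y₃(k)` = exactly 8» / rank `E′(k) = 0` and everything sieve-related stay NAMED; «a certified finite
datum is not a modularity statement»; nothing here proves modularity of any elliptic curve.
References: cell files E8-MODELS.md (v2, «THEOREM … X(s3,H12)(ℚ(√5)) = the 8 cusps»), E8-POINTS.md;
Cremona label 225a1; [Zywina2015] arXiv:1508.07660 §1.2–1.3 for `J₂`, `J₇`.
-/

set_option linter.dupNamespace false -- project-wide option; `Summit.Langlands.Langlands` is the mandated namespace

namespace Summit.Langlands.Langlands.Theorems.SqrtFiveQuarticCovers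

/-! ### §1 Non-squares in `ℚ` by a residue mod `7` -/

/-- A natural number that is `3, 5` or `6 mod 7` is not a square (the squares mod `7` are
`0, 1, 2, 4`). [folklore] -/
theorem not_isSquare_nat_of_mod_seven {n : ℕ} (h : (n : ZMod 7) = 3 ∨ (n : ZMod 7) = 5 ∨ (n : ZMod 7) = 6) :
    ¬ IsSquare n := by
  rintro ⟨m, hm⟩
  have hm7 : (n : ZMod 7) = (m : ZMod 7) * (m : ZMod 7) := by exact_mod_cast congrArg (Nat.cast : ℕ → ZMod 7) hm
  have key : ∀ a : ZMod 7, a * a ≠ 3 ∧ a * a ≠ 5 ∧ a * a ≠ 6 := by decide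
  obtain ⟨k3, k5, k6⟩ := key (m : ZMod 7)
  rcases h with h | h | h
  · exact k3 (hm7.symm.trans h)
  · exact k5 (hm7.symm.trans h)
  · exact k6 (hm7.symm.trans h)

/-- `5`, `125989 = 19²·349 = N(A(2G∓T))`, `1055725 = 8725·121 = 121²·N(B(2G∓T))`, `3645 = 5²·N(B(O))`
and `320 = 5²·N(B(−2G))` are not squares of rational numbers (residues `5, 3, 3, 5, 5 mod 7`).
[folklore] -/
theorem not_isSquare_rat_five_and_norms :
    ¬ IsSquare (5 : ℚ) ∧ ¬ IsSquare (125989 : ℚ) ∧ ¬ IsSquare (1055725 : ℚ) ∧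
      ¬ IsSquare (3645 : ℚ) ∧ ¬ IsSquare (320 : ℚ) := by
  refine ⟨?_, ?_, ?_, ?_, ?_⟩ <;> rw [Rat.isSquare_ofNat_iff] <;>
    exact not_isSquare_nat_of_mod_seven (by decide)

/-! ### §2 `{1, r}` is `ℚ`-free and the norm form of `ℚ(r)`, `r² = 5` -/

/-- **`{1, r}` is linearly independent over `ℚ`** in any field of characteristic `0` with `r² = 5`:
`p + q·r = 0` with `p q : ℚ` forces `p = q = 0` (else `r = −p/q ∈ ℚ` and `5 = r²` would be a rational
square). [folklore] -/
theorem ratCast_add_ratCast_mul_eq_zero {F : Type*} [Field F] [CharZero F] {r : F} (hr : r ^ 2 = 5)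
    {p q : ℚ} (h : (p : F) + (q : F) * r = 0) : p = 0 ∧ q = 0 := by
  by_cases hq : q = 0
  · subst hq
    simp only [Rat.cast_zero, zero_mul, add_zero, Rat.cast_eq_zero] at h
    exact ⟨h, rfl⟩
  · exfalso
    have hqF : (q : F) ≠ 0 := Rat.cast_ne_zero.mpr hq
    have hrq : r = ((-p / q : ℚ) : F) := by
      push_cast
      field_simp
      linear_combination h
    have h5 : ((-p / q) ^ 2 : ℚ) = 5 := by
      have : (((-p / q) ^ 2 : ℚ) : F) = ((5 : ℚ) : F) := by push_cast; rw [← hr, hrq]; push_cast; ring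
      exact_mod_cast this
    exact not_isSquare_rat_five_and_norms.1 ⟨-p / q, by rw [← sq]; exact h5.symm⟩

/-- **The norm form.**  If `(c + d·r)² = a + b·r` (`a b c d : ℚ`, `r² = 5`, characteristic `0`) then
`c² + 5d² = a`, `2cd = b`, and hence `a² − 5b² = (c² − 5d²)²` is a rational square
(`N_{ℚ(√5)/ℚ}` is multiplicative). [folklore] -/
theorem isSquare_norm_of_sq_eq {F : Type*} [Field F] [CharZero F] {r : F} (hr : r ^ 2 = 5)
    {a b c d : ℚ} (h : ((c : F) + (d : F) * r) ^ 2 = (a : F) + (b : F) * r) :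
    c ^ 2 + 5 * d ^ 2 = a ∧ 2 * c * d = b ∧ IsSquare (a ^ 2 - 5 * b ^ 2) := by
  have h0 : ((c ^ 2 + 5 * d ^ 2 - a : ℚ) : F) + ((2 * c * d - b : ℚ) : F) * r = 0 := by
    push_cast
    linear_combination h - (d : F) ^ 2 * hr
  obtain ⟨h1, h2⟩ := ratCast_add_ratCast_mul_eq_zero hr h0
  refine ⟨by linarith, by linarith, ⟨c ^ 2 - 5 * d ^ 2, ?_⟩⟩
  have ha : a = c ^ 2 + 5 * d ^ 2 := by linarith
  have hb : b = 2 * c * d := by linarith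
  rw [ha, hb]; ring

/-- Contrapositive packaging: if `a² − 5b²` is not a rational square then `a + b·r` is not the square
of any `c + d·r` (`c d : ℚ`), i.e. not a square in `k = ℚ(r)`. [folklore] -/
theorem not_sq_eq_of_not_isSquare_norm {F : Type*} [Field F] [CharZero F] {r : F} (hr : r ^ 2 = 5)
    {a b : ℚ} (hN : ¬ IsSquare (a ^ 2 - 5 * b ^ 2)) (c d : ℚ) :
    ((c : F) + (d : F) * r) ^ 2 ≠ (a : F) + (b : F) * r :=
  fun h => hN (isSquare_norm_of_sq_eq hr h).2.2

/-! ### §3 The four CASE-1 fibres of `X(s3,H12) → 225a1` are quadratic over `k`, not `k`-rational -/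

/-- Rescaling a rational square: `IsSquare x → IsSquare (m²·x)`. [folklore] -/
theorem isSquare_mul_sq_of_isSquare {x : ℚ} (hx : IsSquare x) (m : ℚ) : IsSquare (m ^ 2 * x) := by
  obtain ⟨y, hy⟩ := hx
  exact ⟨m * y, by rw [hy]; ring⟩

/-- **`A(2G−T) = 1259/2 + 465/2·r` and `A(2G+T) = 1259/2 − 465/2·r` are not squares in `k`**
(`N = (1259/2)² − 5(465/2)² = 125989 = 19²·349`, `≡ 3 mod 7`; E8-MODELS v2 kit j312432
«A_sq False» for rows `2G±T`, eng-5 lift test).  Hence the `X(s3)`-sheet does not split over these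
points: `K = k(√A)` is a genuine quadratic extension (`= ℚ(θ)` of the anchors file). [folklore] -/
theorem caseOne_A_not_square {F : Type*} [Field F] [CharZero F] {r : F} (hr : r ^ 2 = 5) (c d : ℚ) :
    ((c : F) + (d : F) * r) ^ 2 ≠ ((1259 / 2 : ℚ) : F) + ((465 / 2 : ℚ) : F) * r ∧
      ((c : F) + (d : F) * r) ^ 2 ≠ ((1259 / 2 : ℚ) : F) + ((-465 / 2 : ℚ) : F) * r := by
  have hN : ¬ IsSquare ((1259 / 2 : ℚ) ^ 2 - 5 * (465 / 2) ^ 2) := by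
    norm_num -- evaluates to `¬ IsSquare 125989` and decides it
  have hN' : ¬ IsSquare ((1259 / 2 : ℚ) ^ 2 - 5 * (-465 / 2) ^ 2) := by
    norm_num
  exact ⟨not_sq_eq_of_not_isSquare_norm hr hN c d, not_sq_eq_of_not_isSquare_norm hr hN' c d⟩

/-- **`B(2G−T) = (1535 − 510r)/121` and `B(2G+T) = (3615 − 1550r)/121` are not squares in `k`**,
and neither are their `r ↦ −r` conjugates (the `B`-values of the conjugate model): all four have
`N = a² − 5b² = 8725/121`, `121²·N = 1055725 ≡ 3 mod 7` (E8-MODELS v2 «B(R) ∉ k²», eng-5 10/10).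
Hence the `H12`-sheet does not split over `2G∓T` either; with `A·B ∈ k²` (anchors file
`caseOne_fibre_Rminus`) the four points of `X` over each `R = 2G∓T` live over the quadratic extension
`k(√A) = k(√B)` of `k` and are NOT `k`-rational. [folklore] -/
theorem caseOne_B_not_square {F : Type*} [Field F] [CharZero F] {r : F} (hr : r ^ 2 = 5) (c d : ℚ) :
    ((c : F) + (d : F) * r) ^ 2 ≠ ((1535 / 121 : ℚ) : F) + ((-510 / 121 : ℚ) : F) * r ∧
      ((c : F) + (d : F) * r) ^ 2 ≠ ((3615 / 121 : ℚ) : F) + ((-1550 / 121 : ℚ) : F) * r ∧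
      ((c : F) + (d : F) * r) ^ 2 ≠ ((1535 / 121 : ℚ) : F) + ((510 / 121 : ℚ) : F) * r ∧
      ((c : F) + (d : F) * r) ^ 2 ≠ ((3615 / 121 : ℚ) : F) + ((1550 / 121 : ℚ) : F) * r := by
  have key : ∀ a b : ℚ, a ^ 2 - 5 * b ^ 2 = 8725 / 121 → ¬ IsSquare (a ^ 2 - 5 * b ^ 2) := by
    intro a b hab hsq
    rw [hab] at hsq
    have h3 := isSquare_mul_sq_of_isSquare hsq 121
    norm_num at h3 -- `IsSquare 1055725` is decided false
  exact ⟨not_sq_eq_of_not_isSquare_norm hr (key _ _ (by norm_num)) c d,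
    not_sq_eq_of_not_isSquare_norm hr (key _ _ (by norm_num)) c d,
    not_sq_eq_of_not_isSquare_norm hr (key _ _ (by norm_num)) c d,
    not_sq_eq_of_not_isSquare_norm hr (key _ _ (by norm_num)) c d⟩

/-- **The `j = 0` fibre: `B(O) = 27/c = 27(5−2r)/5 = 27 − (54/5)·r` is not a square in `k`**
(`N = 27² − 5(54/5)² = 729/5`, `25·N = 3645 ≡ 5 mod 7`), while `A(O) = 0² + 12·0 + 144 = 12²` IS
(`m(O) = 0`): the four points of `X` over `O` are quadratic over `k(√(27/c))` (E8-MODELS v2: «over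
R = O: 4 points, j = 0 (CM), K = k(√(27/c)) = ℚ(ζ₁₅)⁺ (x⁴−10x²−15x−5)»; `(O, ±12) ∈ X(s3,ns⁺5)(ℚ)`).
We also record `(5 + 2r)·(27(5−2r)/5) = 27`, i.e. `27/c = 27(5−2r)/5`; the `+54/5` clause is the
conjugate model's value. [folklore] -/
theorem caseOne_B_at_O_not_square {F : Type*} [Field F] [CharZero F] {r : F} (hr : r ^ 2 = 5) (c d : ℚ) :
    ((c : F) + (d : F) * r) ^ 2 ≠ ((27 : ℚ) : F) + ((-54 / 5 : ℚ) : F) * r ∧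
      ((c : F) + (d : F) * r) ^ 2 ≠ ((27 : ℚ) : F) + ((54 / 5 : ℚ) : F) * r ∧
      (5 + 2 * r) * (27 * (5 - 2 * r) / 5) = 27 ∧ ((0 : ℚ) ^ 2 + 12 * 0 + 144 = 12 ^ 2) := by
  have key : ∀ s : ℚ, s = 54 / 5 ∨ s = -54 / 5 → ¬ IsSquare ((27 : ℚ) ^ 2 - 5 * s ^ 2) := by
    rintro s hs hsq
    have h2 : (27 : ℚ) ^ 2 - 5 * s ^ 2 = 729 / 5 := by rcases hs with rfl | rfl <;> norm_num
    rw [h2] at hsq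
    have h3 := isSquare_mul_sq_of_isSquare hsq 5
    norm_num at h3 -- `IsSquare 3645` is decided false
  refine ⟨not_sq_eq_of_not_isSquare_norm hr (key _ (Or.inr rfl)) c d,
    not_sq_eq_of_not_isSquare_norm hr (key _ (Or.inl rfl)) c d, ?_, by norm_num⟩
  linear_combination (-108 / 5 : F) * hr

/-- **The `j = 8000` fibre: `B(−2G) ≡ 8/c = 8(5−2r)/5 = 8 − (16/5)·r` (mod squares) is not a square
in `k`** (`N = 64 − 5(16/5)² = 64/5`, `25·N = 320 ≡ 5 mod 7`), while `A(−2G) = 20² + 12·20 + 144 =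
784 = 28²` IS: the four points of `X` over `−2G` are quadratic over `k(√(8/c)) = ℚ(√(5+√5))`
(E8-MODELS v2: «over R = −2G: 4 points, j = 8000 (CM, D = −8), K = k(√(8/c)): x⁴ − 10x² + 20»;
`(−2G, ±28) ∈ X(s3,ns⁺5)(ℚ)`).  At `t = ∞` the conic `c·w² = 8t² − 12t + 7` reads `c·(w/t)² → 8`,
whence the class `8/c`; `(5+2r)·(8(5−2r)/5) = 8`. [folklore] -/
theorem caseOne_B_at_negTwoG_not_square {F : Type*} [Field F] [CharZero F] {r : F} (hr : r ^ 2 = 5)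
    (c d : ℚ) :
    ((c : F) + (d : F) * r) ^ 2 ≠ ((8 : ℚ) : F) + ((-16 / 5 : ℚ) : F) * r ∧
      ((c : F) + (d : F) * r) ^ 2 ≠ ((8 : ℚ) : F) + ((16 / 5 : ℚ) : F) * r ∧
      (5 + 2 * r) * (8 * (5 - 2 * r) / 5) = 8 ∧ ((20 : ℚ) ^ 2 + 12 * 20 + 144 = 28 ^ 2) := by
  have key : ∀ s : ℚ, s = 16 / 5 ∨ s = -16 / 5 → ¬ IsSquare ((8 : ℚ) ^ 2 - 5 * s ^ 2) := by
    rintro s hs hsq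
    have h2 : (8 : ℚ) ^ 2 - 5 * s ^ 2 = 64 / 5 := by rcases hs with rfl | rfl <;> norm_num
    rw [h2] at hsq
    have h3 := isSquare_mul_sq_of_isSquare hsq 5
    norm_num at h3 -- `IsSquare 320` is decided false
  refine ⟨not_sq_eq_of_not_isSquare_norm hr (key _ (Or.inr rfl)) c d,
    not_sq_eq_of_not_isSquare_norm hr (key _ (Or.inl rfl)) c d, ?_, by norm_num⟩
  linear_combination (-32 / 5 : F) * hr

/-- **Summary in the coordinates of `hDat`'s conic.**  For `r² = 5` and `c d : ℚ`, the `H12`-conic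
equation `(5 + 2r)·w² = q` has NO solution `w = c + d·r ∈ k` for `q ∈ {27, 8·(square), q(t(2G∓T))}`:
`(5+2r)(c+dr)² = 27` is impossible, `(5+2r)(c+dr)² = 8` is impossible, and
`(5+2r)(c+dr)² = (2575 ± 520r)/121 = q(t(2G∓T))` is impossible — the `w`-coordinate of a point of `X(s3,H12)` over
`O` (`t = −1`, `q(−1) = 27`), over `−2G` (`t = ∞`, leading coefficient `8`) or over `2G∓T` never lies
in `k`.  (Over the cusps `±T` it does: anchors file `s3h12_model_cuspNodes`.) [folklore] -/
theorem conic_no_k_point_over_caseOne {F : Type*} [Field F] [CharZero F] {r : F} (hr : r ^ 2 = 5)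
    (c d : ℚ) :
    (5 + 2 * r) * ((c : F) + (d : F) * r) ^ 2 ≠ 27 ∧ (5 + 2 * r) * ((c : F) + (d : F) * r) ^ 2 ≠ 8 ∧
      (5 + 2 * r) * ((c : F) + (d : F) * r) ^ 2 ≠ (2575 + 520 * r) / 121 ∧
      (5 + 2 * r) * ((c : F) + (d : F) * r) ^ 2 ≠ (2575 - 520 * r) / 121 := by
  have hc : (5 + 2 * r) * (5 - 2 * r) = (5 : F) := by linear_combination (-4 : F) * hr
  have h52 : (5 : F) + 2 * r ≠ 0 := by
    intro h; have : (5 : F) = 0 := by rw [← hc, h, zero_mul]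
    norm_num at this
  refine ⟨?_, ?_, ?_, ?_⟩
  · intro h
    apply (caseOne_B_at_O_not_square hr c d).1
    push_cast
    linear_combination ((5 - 2 * r) / 5) * h + ((4 * ((c : F) + (d : F) * r) ^ 2) / 5) * hr
  · intro h
    apply (caseOne_B_at_negTwoG_not_square hr c d).1
    push_cast
    linear_combination ((5 - 2 * r) / 5) * h + ((4 * ((c : F) + (d : F) * r) ^ 2) / 5) * hr
  · intro h
    apply (caseOne_B_not_square hr c d).1
    push_cast
    linear_combination ((5 - 2 * r) / 5) * h
      + ((4 * ((c : F) + (d : F) * r) ^ 2) / 5 - 208 / 121) * hr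
  · intro h
    apply (caseOne_B_not_square hr c d).2.1
    push_cast
    linear_combination ((5 - 2 * r) / 5) * h
      + ((4 * ((c : F) + (d : F) * r) ^ 2) / 5 + 208 / 121) * hr

end Summit.Langlands.Langlands.Theorems.SqrtFiveQuarticCovers
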